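import Summits.QuantumFields.YangMills.Theorems.AllWindowsColdBoxBoxMidWindowsSU22LineDefs
import Summits.QuantumFields.YangMills.Theorems.AllWindowsColdBoxPiMultivariateGaussianHypercontractivity
import Summits.QuantumFields.YangMills.Theorems.WeakCouplingRatesColdBoxDirichletPosDef
import Mathlib.Analysis.SpecialFunctions.Log.Basic
import HarnessLib

/-!
# LINE-17 «hypercontractive second-order tilt expansion» on crux `AllWindowsColdBox.BoxMidWindowsSU22` (stmt-QuantumFields-24003):
# the dominators `Σ_e ‖a_e‖²`, `Σ_e ‖a_e‖⁴` of the tilt (STUB-PLAN-E §1, E(4), E(5), E(7) caps)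

STUB-PLAN-E (planner ym-idea-2 g15) §1 writes the tilt of the one-scale expansion on the small-field event as
`tiltWE = V₃ − ΣR₄ + Σ_e log J(a_e)` with `|ΣR₄| ≤ C·Q₄(t)/β` (E(0), `…PlaqCostCubicTaylor.abs_tiltWE_sub_tiltCubicW_sub_log_le`:
remainder `≤ 560·β·Σ_{q touching Λ} Σ_{legs} ‖a_leg‖⁴`, `a = extZero (unscaleTE t) = t/√β`) and `|Σ log J| ≤ 2C₂·Q₂(t)/β`.  This file supplies
the two DOMINATORS `Σ_e ‖a_e‖² = Q₂(t)/β` and `Σ_e ‖a_e‖⁴ = Q₄(t)/β²` (`a_e = unscaleTE H D β t e`, `Q₂ = Σ_{e,a} (t a)_e²`,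
`Q₄ = Σ_e (Σ_a (t a)_e²)²`) and everything E(4)/E(5)/E(7)/E(8) need about them short of Wick moments — with NO new definition:

* §1 `‖a_e‖² = Σ_a (t a)_e²/β`, `Σ_e ‖a_e‖² = Q₂/β`, `Σ_e ‖a_e‖⁴ = Q₄/β²` (explicit coordinate sums; `β ≥ 0`).
* §2 LEG COUNT (H-uniform): `Σ_{q touching Λ} Σ_{4 legs} f(extZero w (leg)) ≤ 24·Σ_{e free} f(w e)` for `f ≥ 0`, `f 0 = 0` — each leg slot
  `q ↦ leg_k(q)` has fibres of size `≤ 6` (a plaquette with a given `k`-th leg is determined by its plane); hence E(0)'s remainder is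
  `≤ 13440·β·Σ_e ‖a_e‖⁴` (`sum_touching_legs_norm_pow_four_le`, `remainder_le_sum_norm_pow_four`).
* §3 `|Σ_e log J(a_e)| ≤ 2C₂·Σ_e ‖a_e‖²` under the `AdmissibleDensity` inequalities on the ball `‖a_e‖ ≤ r₂` (`|log x| ≤ 2|x − 1|`, `x ≥ 1/2`).
* §4 HYPERCONTRACTIVE MOMENTS: `Σ_e‖a_e‖²`, `Σ_e‖a_e‖⁴` are `β⁻¹·eval X P₂`, `β⁻²·eval X P₄` for explicit polynomials of total degree
  `≤ 2, 4` in the variables of `pi_multivariateGaussian_bonami` (`X (a,e) t = WithLp.ofLp (t a) e`), whence for every real `c` and `k ≥ 1`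
  `∫ (c·Σ_e‖a_e‖²)^{2k} dγ ≤ (2k−1)^{2k}(∫(c·Σ_e‖a_e‖²)²dγ)^k`, `∫ (c·Σ_e‖a_e‖⁴)^{2k} dγ ≤ (2k−1)^{4k}(∫(c·Σ_e‖a_e‖⁴)²dγ)^k`
  (`γ = gaussD H D`) — the input shape of `…AllWindowsColdBox.CappedExpMoment.setIntegral_exp_mul_abs_le_of_moments` with `m = 2, 4`.
* §5 CAPS on `{∀ e, ‖a_e‖ ≤ R}`: `Σ_e‖a_e‖² ≤ #E_f·R²`, `Σ_e‖a_e‖⁴ ≤ #E_f·R⁴` (`#E_f = Fintype.card (ColdFreeIdx H)`); measurability.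

(The Wick second moments `∫(Σ‖a‖²)², ∫(Σ‖a‖⁴)²` via `integral_coord_pow_even_gaussD_le` and the cap of `V₃` follow in a sibling file.)
HONEST LABEL: helper lemmas toward the OPEN registered stub E `stub_tiltMoments` of one critic-PASSed line on the R2ξ″ RECORD-rung crux
24003; no stub is proved by name, no crux, rung or summit is proved; the Yang–Mills mass gap is NOT proved by this file.
-/

set_option autoImplicit false

noncomputable section

open MeasureTheory ProbabilityTheory Finset MvPolynomial
open Literature.MathematicalPhysics.QuantumLattice
open Literature.MathematicalPhysics.QuantumFieldTheory
open Literature.MathematicalPhysics.QuantumFieldTheory.LatticeMaxwell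
open Summit.QuantumFields.YangMills.Theorems.WeakCouplingRates
open Summit.QuantumFields.YangMills.Theorems.ColdBoxAllGroups
open Summit.QuantumFields.YangMills.Theorems.FreeEnergyLogCoefficient

namespace Summit.QuantumFields.YangMills.Theorems.AllWindowsColdBoxBoxMidLine

/-! ## §1 The dominators and the unscaled chart coordinates -/

section Defs

variable {H D : ℕ}

/-- **The unscaled chart coordinate has squared norm `‖t_e‖²/β`**: `‖unscaleTE H D β t e‖² = Σ_a (t a)_{σ⁻¹e}²/β` (`β ≥ 0`,
`σ = dirFreeEquiv H`). -/
theorem norm_unscaleTE_sq {β : ℝ} (hβ : 0 ≤ β) (t : TSpaceD H D) (e : ColdFreeIdx H) :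
    ‖unscaleTE H D β t e‖ ^ 2 = (∑ a : Fin D, WithLp.ofLp (t a) ((dirFreeEquiv H).symm e) ^ 2) / β := by
  rw [EuclideanSpace.norm_sq_eq]
  simp only [unscaleTE_apply, Real.norm_eq_abs, sq_abs, div_pow, Real.sq_sqrt hβ, Finset.sum_div]

/-- `‖unscaleTE H D β t e‖⁴ = (Σ_a (t a)_{σ⁻¹e}²)²/β²` (`β ≥ 0`). -/
theorem norm_unscaleTE_pow_four {β : ℝ} (hβ : 0 ≤ β) (t : TSpaceD H D) (e : ColdFreeIdx H) :
    ‖unscaleTE H D β t e‖ ^ 4 = (∑ a : Fin D, WithLp.ofLp (t a) ((dirFreeEquiv H).symm e) ^ 2) ^ 2 / β ^ 2 := by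
  rw [show ‖unscaleTE H D β t e‖ ^ 4 = (‖unscaleTE H D β t e‖ ^ 2) ^ 2 by ring, norm_unscaleTE_sq hβ, div_pow]

/-- **`Σ_e ‖a_e‖² = Q₂(t)/β`**, `Q₂ = Σ_e Σ_a (t a)_e²`, over the free links (`β ≥ 0`). -/
theorem sum_norm_unscaleTE_sq {β : ℝ} (hβ : 0 ≤ β) (t : TSpaceD H D) :
    ∑ e : ColdFreeIdx H, ‖unscaleTE H D β t e‖ ^ 2 = (∑ e : DirFree H, ∑ a : Fin D, WithLp.ofLp (t a) e ^ 2) / β := by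
  calc ∑ e : ColdFreeIdx H, ‖unscaleTE H D β t e‖ ^ 2
      = ∑ e : ColdFreeIdx H, (∑ a : Fin D, WithLp.ofLp (t a) ((dirFreeEquiv H).symm e) ^ 2) / β :=
        sum_congr rfl fun e _ => norm_unscaleTE_sq hβ t e
    _ = (∑ e : ColdFreeIdx H, ∑ a : Fin D, WithLp.ofLp (t a) ((dirFreeEquiv H).symm e) ^ 2) / β := (Finset.sum_div _ _ _).symm
    _ = _ := by rw [(dirFreeEquiv H).symm.sum_comp (fun e => ∑ a : Fin D, WithLp.ofLp (t a) e ^ 2)]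

/-- **`Σ_e ‖a_e‖⁴ = Q₄(t)/β²`**, `Q₄ = Σ_e (Σ_a (t a)_e²)²`, over the free links (`β ≥ 0`). -/
theorem sum_norm_unscaleTE_pow_four {β : ℝ} (hβ : 0 ≤ β) (t : TSpaceD H D) :
    ∑ e : ColdFreeIdx H, ‖unscaleTE H D β t e‖ ^ 4 =
      (∑ e : DirFree H, (∑ a : Fin D, WithLp.ofLp (t a) e ^ 2) ^ 2) / β ^ 2 := by
  calc ∑ e : ColdFreeIdx H, ‖unscaleTE H D β t e‖ ^ 4
      = ∑ e : ColdFreeIdx H, (∑ a : Fin D, WithLp.ofLp (t a) ((dirFreeEquiv H).symm e) ^ 2) ^ 2 / β ^ 2 :=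
        sum_congr rfl fun e _ => norm_unscaleTE_pow_four hβ t e
    _ = (∑ e : ColdFreeIdx H, (∑ a : Fin D, WithLp.ofLp (t a) ((dirFreeEquiv H).symm e) ^ 2) ^ 2) / β ^ 2 :=
        (Finset.sum_div _ _ _).symm
    _ = _ := by rw [(dirFreeEquiv H).symm.sum_comp (fun e => (∑ a : Fin D, WithLp.ofLp (t a) e ^ 2) ^ 2)]

/-- `t ↦ ‖unscaleTE H D β t e‖ ^ n` is measurable. -/
theorem measurable_norm_unscaleTE_pow (β : ℝ) (e : ColdFreeIdx H) (n : ℕ) :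
    Measurable fun t : TSpaceD H D => ‖unscaleTE H D β t e‖ ^ n :=
  (((measurable_pi_apply e).comp (measurable_unscaleTE (H := H) D β)).norm).pow_const n

/-- `t ↦ Σ_e ‖unscaleTE H D β t e‖ ^ n` is measurable. -/
theorem measurable_sum_norm_unscaleTE_pow (β : ℝ) (n : ℕ) :
    Measurable fun t : TSpaceD H D => ∑ e : ColdFreeIdx H, ‖unscaleTE H D β t e‖ ^ n :=
  Finset.measurable_sum _ fun e _ => measurable_norm_unscaleTE_pow β e n

end Defs

/-! ## §2 The leg count: each edge is the `k`-th leg of at most `6` plaquettes -/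

section Legs

variable {H : ℕ}

/-- **Fibre bound for one leg slot.**  If `leg : plaquette ↦ edge` is such that a plaquette is determined by its leg and its plane
(`leg q = leg q' → q.2 = q'.2 → q = q'`), then for `φ ≥ 0`: `Σ_{q ∈ P} φ(leg q) ≤ 6·Σ_{e ∈ leg(P)} φ(e)` (`6 = #planes of ℤ⁴`). -/
theorem sum_comp_leg_le (P : Finset (ZdPlaquette 4)) (leg : ZdPlaquette 4 → Literature.MathematicalPhysics.QuantumLattice.ZdEdge 4)
    (hinj : ∀ q q' : ZdPlaquette 4, leg q = leg q' → q.2 = q'.2 → q = q') (φ : Literature.MathematicalPhysics.QuantumLattice.ZdEdge 4 → ℝ) (hφ : ∀ e, 0 ≤ φ e) :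
    ∑ q ∈ P, φ (leg q) ≤ 6 * ∑ e ∈ P.image leg, φ e := by
  classical
  rw [← Finset.sum_fiberwise_of_maps_to (s := P) (t := P.image leg) (g := leg) fun q hq => mem_image_of_mem leg hq, mul_sum]
  refine sum_le_sum fun e _ => ?_
  have hconst : ∑ q ∈ P with leg q = e, φ (leg q) = ∑ q ∈ P with leg q = e, φ e :=
    sum_congr rfl fun q hq => by rw [(mem_filter.1 hq).2]
  rw [hconst, sum_const, nsmul_eq_mul]
  refine mul_le_mul_of_nonneg_right ?_ (hφ e)
  have hcard : #{q ∈ P | leg q = e} ≤ (Finset.univ : Finset {p : Fin 4 × Fin 4 // p.1 < p.2}).card := by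
    refine Finset.card_le_card_of_injOn (fun q => q.2) (fun _ _ => mem_coe.2 (mem_univ _)) ?_
    intro q hq q' hq' h
    exact hinj q q' (((mem_filter.1 (mem_coe.1 hq)).2).trans ((mem_filter.1 (mem_coe.1 hq')).2).symm) h
  have h6 : (Finset.univ : Finset {p : Fin 4 × Fin 4 // p.1 < p.2}).card = 6 := by decide
  rw [h6] at hcard
  exact_mod_cast hcard

/-- Leg 1 `q ↦ (x, i)` determines the plaquette given its plane. -/
theorem leg₁_inj (q q' : ZdPlaquette 4) (h : ((q.1, q.2.1.1) : Literature.MathematicalPhysics.QuantumLattice.ZdEdge 4) = (q'.1, q'.2.1.1)) (h2 : q.2 = q'.2) : q = q' :=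
  Prod.ext (Prod.mk.inj h).1 h2

/-- Leg 2 `q ↦ (x + eᵢ, j)` determines the plaquette given its plane. -/
theorem leg₂_inj (q q' : ZdPlaquette 4)
    (h : ((q.1 + Pi.single q.2.1.1 1, q.2.1.2) : Literature.MathematicalPhysics.QuantumLattice.ZdEdge 4) = (q'.1 + Pi.single q'.2.1.1 1, q'.2.1.2)) (h2 : q.2 = q'.2) : q = q' := by
  refine Prod.ext ?_ h2
  have h1 := (Prod.mk.inj h).1
  rw [h2] at h1
  exact add_right_cancel h1

/-- Leg 3 `q ↦ (x + eⱼ, i)` determines the plaquette given its plane. -/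
theorem leg₃_inj (q q' : ZdPlaquette 4)
    (h : ((q.1 + Pi.single q.2.1.2 1, q.2.1.1) : Literature.MathematicalPhysics.QuantumLattice.ZdEdge 4) = (q'.1 + Pi.single q'.2.1.2 1, q'.2.1.1)) (h2 : q.2 = q'.2) : q = q' := by
  refine Prod.ext ?_ h2
  have h1 := (Prod.mk.inj h).1
  rw [h2] at h1
  exact add_right_cancel h1

/-- Leg 4 `q ↦ (x, j)` determines the plaquette given its plane. -/
theorem leg₄_inj (q q' : ZdPlaquette 4) (h : ((q.1, q.2.1.2) : Literature.MathematicalPhysics.QuantumLattice.ZdEdge 4) = (q'.1, q'.2.1.2)) (h2 : q.2 = q'.2) : q = q' :=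
  Prod.ext (Prod.mk.inj h).1 h2

/-- **A zero-extended function sums over any finite edge set to at most its sum over the free links**: for `f ≥ 0` with `f 0 = 0`,
`Σ_{e ∈ T} f(extZero w e) ≤ Σ_{e' free} f(w e')`. -/
theorem sum_extZero_le {V : Type*} [Zero V] (w : ColdFreeIdx H → V) (f : V → ℝ) (hf0 : f 0 = 0) (hf : ∀ v, 0 ≤ f v)
    (T : Finset (Literature.MathematicalPhysics.QuantumLattice.ZdEdge 4)) : ∑ e ∈ T, f (extZero w e) ≤ ∑ e' : ColdFreeIdx H, f (w e') := by
  classical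
  -- the free links as a finset of edges
  set F : Finset (Literature.MathematicalPhysics.QuantumLattice.ZdEdge 4) := (Finset.univ : Finset (ColdFreeIdx H)).image fun e' => e'.1.1 with hF
  have hFinj : Set.InjOn (fun e' : ColdFreeIdx H => (e'.1.1 : Literature.MathematicalPhysics.QuantumLattice.ZdEdge 4)) (Finset.univ : Finset (ColdFreeIdx H)) :=
    fun a _ b _ h => Subtype.ext (Subtype.ext h)
  have hsumF : ∑ e ∈ F, f (extZero w e) = ∑ e' : ColdFreeIdx H, f (w e') := by
    rw [hF, sum_image hFinj]
    exact sum_congr rfl fun e' _ => by rw [extZero_apply_free]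
  -- off `F` the zero extension vanishes
  have hzero : ∀ e, e ∉ F → extZero w e = 0 := by
    intro e he
    unfold extZero
    by_cases hb : e ∈ AxialGauge.boxEdges 4 (2 * H + 1)
    · rw [dif_pos hb]
      by_cases hfo : (e.2 = 0 ∧ ∀ k : Fin 4, 1 ≤ e.1 k ∧ e.1 k + 1 ≤ 2 * (H : ℤ))
      · rw [dif_pos hfo]
      · exfalso; apply he
        rw [hF, mem_image]
        exact ⟨⟨⟨e, hb⟩, hfo⟩, mem_univ _, rfl⟩
    · rw [dif_neg hb]
  calc ∑ e ∈ T, f (extZero w e)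
      = ∑ e ∈ T with e ∈ F, f (extZero w e) + ∑ e ∈ T with ¬ e ∈ F, f (extZero w e) :=
        (sum_filter_add_sum_filter_not T (· ∈ F) _).symm
    _ = ∑ e ∈ T with e ∈ F, f (extZero w e) := by
        rw [add_eq_left]
        exact sum_eq_zero fun e he => by rw [hzero e (mem_filter.1 he).2, hf0]
    _ ≤ ∑ e ∈ F, f (extZero w e) :=
        sum_le_sum_of_subset_of_nonneg (fun e he => (mem_filter.1 he).2) fun e _ _ => hf _
    _ = _ := hsumF

/-- **The leg count.**  For `f ≥ 0` with `f 0 = 0` and any free-link data `w`,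
`Σ_{q touching Λ} (f(a(l₁q)) + f(a(l₂q)) + f(a(l₃q)) + f(a(l₄q))) ≤ 24·Σ_{e free} f(w e)` where `a = extZero w` and `l₁..l₄` are the four legs
of `q` in path order — uniformly in `H` (each slot contributes `≤ 6·Σ`). -/
theorem sum_touching_legs_le {V : Type*} [Zero V] (w : ColdFreeIdx H → V) (f : V → ℝ) (hf0 : f 0 = 0) (hf : ∀ v, 0 ≤ f v)
    (P : Finset (ZdPlaquette 4)) :
    ∑ q ∈ P, (f (extZero w (q.1, q.2.1.1)) + f (extZero w (q.1 + Pi.single q.2.1.1 1, q.2.1.2)) +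
        f (extZero w (q.1 + Pi.single q.2.1.2 1, q.2.1.1)) + f (extZero w (q.1, q.2.1.2))) ≤
      24 * ∑ e' : ColdFreeIdx H, f (w e') := by
  set φ : Literature.MathematicalPhysics.QuantumLattice.ZdEdge 4 → ℝ := fun e => f (extZero w e) with hφ
  have hφ0 : ∀ e, 0 ≤ φ e := fun e => hf _
  have h1 := sum_comp_leg_le P (fun q => (q.1, q.2.1.1)) leg₁_inj φ hφ0
  have h2 := sum_comp_leg_le P (fun q => (q.1 + Pi.single q.2.1.1 1, q.2.1.2)) leg₂_inj φ hφ0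
  have h3 := sum_comp_leg_le P (fun q => (q.1 + Pi.single q.2.1.2 1, q.2.1.1)) leg₃_inj φ hφ0
  have h4 := sum_comp_leg_le P (fun q => (q.1, q.2.1.2)) leg₄_inj φ hφ0
  have g1 := sum_extZero_le w f hf0 hf (P.image fun q => (q.1, q.2.1.1))
  have g2 := sum_extZero_le w f hf0 hf (P.image fun q => (q.1 + Pi.single q.2.1.1 1, q.2.1.2))
  have g3 := sum_extZero_le w f hf0 hf (P.image fun q => (q.1 + Pi.single q.2.1.2 1, q.2.1.1))
  have g4 := sum_extZero_le w f hf0 hf (P.image fun q => (q.1, q.2.1.2))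
  simp only [hφ] at h1 h2 h3 h4
  rw [sum_add_distrib, sum_add_distrib, sum_add_distrib]
  linarith

/-- **The quartic leg sum is dominated by `Σ_e ‖w e‖⁴`** (normed values): `Σ_{q ∈ P} Σ_{legs} ‖extZero w (leg)‖⁴ ≤ 24·Σ_e ‖w e‖⁴`. -/
theorem sum_touching_legs_norm_pow_four_le {V : Type*} [NormedAddCommGroup V] (w : ColdFreeIdx H → V)
    (P : Finset (ZdPlaquette 4)) :
    ∑ q ∈ P, (‖extZero w (q.1, q.2.1.1)‖ ^ 4 + ‖extZero w (q.1 + Pi.single q.2.1.1 1, q.2.1.2)‖ ^ 4 +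
        ‖extZero w (q.1 + Pi.single q.2.1.2 1, q.2.1.1)‖ ^ 4 + ‖extZero w (q.1, q.2.1.2)‖ ^ 4) ≤
      24 * ∑ e : ColdFreeIdx H, ‖w e‖ ^ 4 :=
  sum_touching_legs_le w (fun v : V => ‖v‖ ^ 4) (by simp) (fun v => by positivity) P

/-- **E(0)'s remainder in dominator form**: `560·β·Σ_{q ∈ P} Σ_{legs} ‖a_leg‖⁴ ≤ 13440·β·Σ_e ‖a_e‖⁴` with `a = extZero (unscaleTE H D β t)`
(`β ≥ 0`; `P` = the plaquettes touching the cold box in the application). -/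
theorem remainder_le_sum_norm_pow_four {D : ℕ} {β : ℝ} (hβ : 0 ≤ β) (t : TSpaceD H D) (P : Finset (ZdPlaquette 4)) :
    560 * β * ∑ q ∈ P, (‖extZero (unscaleTE H D β t) (q.1, q.2.1.1)‖ ^ 4 +
        ‖extZero (unscaleTE H D β t) (q.1 + Pi.single q.2.1.1 1, q.2.1.2)‖ ^ 4 +
        ‖extZero (unscaleTE H D β t) (q.1 + Pi.single q.2.1.2 1, q.2.1.1)‖ ^ 4 +
        ‖extZero (unscaleTE H D β t) (q.1, q.2.1.2)‖ ^ 4) ≤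
      13440 * β * ∑ e : ColdFreeIdx H, ‖unscaleTE H D β t e‖ ^ 4 := by
  have h := mul_le_mul_of_nonneg_left (sum_touching_legs_norm_pow_four_le (unscaleTE H D β t) P)
    (by positivity : (0 : ℝ) ≤ 560 * β)
  linarith

end Legs

/-! ## §3 The chart-density logarithms are dominated by `Q₂` -/

section LogDensity

variable {H D : ℕ}

/-- **The chart-density logarithms are dominated by `Σ_e ‖a_e‖²`**: if `|J a − 1| ≤ C₂‖a‖²` and `J a ≥ 1/2` on the ball `‖a‖ ≤ r₂`,
and every unscaled coordinate `a_e = unscaleTE H D β t e` lies in that ball, then `|Σ_e log J(a_e)| ≤ 2C₂·Σ_e ‖a_e‖²`. -/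
theorem abs_sum_log_le_sum_norm_sq {J : EuclideanSpace ℝ (Fin D) → ℝ} {r₂ C₂ : ℝ} (β : ℝ)
    (hJ1 : ∀ a, ‖a‖ ≤ r₂ → |J a - 1| ≤ C₂ * ‖a‖ ^ 2) (hJ2 : ∀ a, ‖a‖ ≤ r₂ → 1 / 2 ≤ J a)
    (t : TSpaceD H D) (ht : ∀ e, ‖unscaleTE H D β t e‖ ≤ r₂) :
    |∑ e : ColdFreeIdx H, Real.log (J (unscaleTE H D β t e))| ≤ 2 * C₂ * ∑ e : ColdFreeIdx H, ‖unscaleTE H D β t e‖ ^ 2 := by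
  -- `|log x| ≤ 2|x − 1|` for `x ≥ 1/2` (cf. the tree's `abs_log_le_two_mul` variants, which assume `|x − 1| ≤ 1/2` instead)
  have hlog : ∀ x : ℝ, 1 / 2 ≤ x → |Real.log x| ≤ 2 * |x - 1| := by
    intro x hx
    have hx0 : 0 < x := by linarith
    rcases le_or_gt 1 x with h1 | h1
    · rw [abs_of_nonneg (Real.log_nonneg h1), abs_of_nonneg (by linarith)]
      linarith [Real.log_le_sub_one_of_pos hx0]
    · rw [abs_of_neg (Real.log_neg hx0 h1), abs_of_neg (by linarith)]
      have h := Real.log_le_sub_one_of_pos (inv_pos.2 hx0)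
      rw [Real.log_inv] at h
      have hinv : x⁻¹ - 1 ≤ 2 * (1 - x) := by
        rw [inv_eq_one_div, div_sub_one hx0.ne', div_le_iff₀ hx0]
        nlinarith
      linarith
  rw [mul_sum]
  refine (abs_sum_le_sum_abs _ _).trans (sum_le_sum fun e _ => ?_)
  have h1 := hlog _ (hJ2 _ (ht e))
  have h2 := hJ1 _ (ht e)
  nlinarith [abs_nonneg (J (unscaleTE H D β t e) - 1)]

/-- The same for an `AdmissibleDensity` of LINE-17 (`D = dimE ρ₂`). -/
theorem abs_sum_log_le_sum_norm_sq_of_admissible {r₂ C₂ : ℝ} {J : EuclideanSpace ℝ (Fin (dimE ρ₂)) → ℝ}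
    (hJ : AdmissibleDensity r₂ C₂ J) (β : ℝ) (t : TSpaceD H (dimE ρ₂)) (ht : ∀ e, ‖unscaleTE H (dimE ρ₂) β t e‖ ≤ r₂) :
    |∑ e : ColdFreeIdx H, Real.log (J (unscaleTE H (dimE ρ₂) β t e))| ≤
      2 * C₂ * ∑ e : ColdFreeIdx H, ‖unscaleTE H (dimE ρ₂) β t e‖ ^ 2 :=
  abs_sum_log_le_sum_norm_sq β hJ.2.2.2.1 (fun a ha => (hJ.2.2.2.2 a ha).1) t ht

end LogDensity

/-! ## §4 The dominators as polynomials in the Gaussian coordinates; hypercontractive moments -/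

section Poly

variable {H D : ℕ}

/-- Scaling a hypercontractive even-moment bound: if `∫ X^{2k} ≤ A·(∫ X²)^k` then `∫ (cX)^{2k} ≤ A·(∫ (cX)²)^k`. -/
theorem integral_const_mul_pow_le {Ω : Type*} [MeasurableSpace Ω] {μ : Measure Ω} {X : Ω → ℝ} {A : ℝ} {k : ℕ}
    (h : ∫ ω, X ω ^ (2 * k) ∂μ ≤ A * (∫ ω, X ω ^ 2 ∂μ) ^ k) (c : ℝ) :
    ∫ ω, (c * X ω) ^ (2 * k) ∂μ ≤ A * (∫ ω, (c * X ω) ^ 2 ∂μ) ^ k := by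
  simp_rw [mul_pow]
  rw [integral_const_mul, integral_const_mul, mul_pow, ← pow_mul, mul_left_comm]
  exact mul_le_mul_of_nonneg_left h (by rw [pow_mul]; positivity)

/-- **`Q₂ = Σ_{e,a} (t a)_e²` is a degree-2 polynomial chaos**: `∫ (c·Q₂)^{2k} dγ ≤ (2k−1)^{2k}·(∫ (c·Q₂)² dγ)^k` (`k ≥ 1`). -/
theorem integral_quadDom_pow_le (c : ℝ) (k : ℕ) (hk : 1 ≤ k) :
    ∫ t, (c * ∑ e : DirFree H, ∑ a : Fin D, WithLp.ofLp (t a) e ^ 2) ^ (2 * k) ∂(gaussD H D) ≤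
      (2 * k - 1 : ℝ) ^ (k * 2) * (∫ t, (c * ∑ e : DirFree H, ∑ a : Fin D, WithLp.ofLp (t a) e ^ 2) ^ 2 ∂(gaussD H D)) ^ k := by
  -- `Q₂ = eval X (Σ_v X_v²)`
  have hP : (∑ v : Fin D × DirFree H, (X v : MvPolynomial (Fin D × DirFree H) ℝ) ^ 2).totalDegree ≤ 2 :=
    totalDegree_finsetSum_le fun v _ => (totalDegree_pow _ _).trans (by norm_num [totalDegree_X])
  have heval : ∀ t : TSpaceD H D, eval (fun v : Fin D × DirFree H => WithLp.ofLp (t v.1) v.2)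
      (∑ v : Fin D × DirFree H, (X v : MvPolynomial (Fin D × DirFree H) ℝ) ^ 2) =
      ∑ e : DirFree H, ∑ a : Fin D, WithLp.ofLp (t a) e ^ 2 := fun t => by
    simp only [map_sum, map_pow, eval_X]
    rw [Fintype.sum_prod_type, Finset.sum_comm]
  have h := Summit.QuantumFields.YangMills.Theorems.AllWindowsColdBox.GaussHypercontractivity.pi_multivariateGaussian_bonami
    (κ := Fin D) ((Qmat (fun e => e ∉ dirFreeEdges H) dirCorner (2 * H + 3))⁻¹) 2 _ hP k hk
  simp only [heval] at h
  exact integral_const_mul_pow_le h c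

/-- **`Q₄ = Σ_e (Σ_a (t a)_e²)²` is a degree-4 polynomial chaos**: `∫ (c·Q₄)^{2k} dγ ≤ (2k−1)^{4k}·(∫ (c·Q₄)² dγ)^k` (`k ≥ 1`). -/
theorem integral_quartDom_pow_le (c : ℝ) (k : ℕ) (hk : 1 ≤ k) :
    ∫ t, (c * ∑ e : DirFree H, (∑ a : Fin D, WithLp.ofLp (t a) e ^ 2) ^ 2) ^ (2 * k) ∂(gaussD H D) ≤
      (2 * k - 1 : ℝ) ^ (k * 4) *
        (∫ t, (c * ∑ e : DirFree H, (∑ a : Fin D, WithLp.ofLp (t a) e ^ 2) ^ 2) ^ 2 ∂(gaussD H D)) ^ k := by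
  have h2 : ∀ e : DirFree H, (∑ a : Fin D, (X (a, e) : MvPolynomial (Fin D × DirFree H) ℝ) ^ 2).totalDegree ≤ 2 := fun e =>
    totalDegree_finsetSum_le fun a _ => (totalDegree_pow _ _).trans (by norm_num [totalDegree_X])
  have hP : (∑ e : DirFree H, (∑ a : Fin D, (X (a, e) : MvPolynomial (Fin D × DirFree H) ℝ) ^ 2) ^ 2).totalDegree ≤ 4 :=
    totalDegree_finsetSum_le fun e _ => (totalDegree_pow _ _).trans (by have := h2 e; omega)
  have heval : ∀ t : TSpaceD H D, eval (fun v : Fin D × DirFree H => WithLp.ofLp (t v.1) v.2)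
      (∑ e : DirFree H, (∑ a : Fin D, (X (a, e) : MvPolynomial (Fin D × DirFree H) ℝ) ^ 2) ^ 2) =
      ∑ e : DirFree H, (∑ a : Fin D, WithLp.ofLp (t a) e ^ 2) ^ 2 := fun t => by
    simp only [map_sum, map_pow, eval_X]
  have h := Summit.QuantumFields.YangMills.Theorems.AllWindowsColdBox.GaussHypercontractivity.pi_multivariateGaussian_bonami
    (κ := Fin D) ((Qmat (fun e => e ∉ dirFreeEdges H) dirCorner (2 * H + 3))⁻¹) 4 _ hP k hk
  simp only [heval] at h
  exact integral_const_mul_pow_le h c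

/-- **Hypercontractive moments of `c·Σ_e ‖a_e‖²`** (`β ≥ 0`): `∫ (c·Σ_e‖a_e‖²)^{2k} dγ ≤ (2k−1)^{2k}·(∫ (c·Σ_e‖a_e‖²)² dγ)^k`, `k ≥ 1` —
the shape `E[X^{2k}] ≤ (2k−1)^{km} s^k` (`m = 2`, `s = E X²`) of `CappedExpMoment.setIntegral_exp_mul_abs_le_of_moments`. -/
theorem integral_sum_norm_unscaleTE_sq_pow_le {β : ℝ} (hβ : 0 ≤ β) (c : ℝ) (k : ℕ) (hk : 1 ≤ k) :
    ∫ t, (c * ∑ e : ColdFreeIdx H, ‖unscaleTE H D β t e‖ ^ 2) ^ (2 * k) ∂(gaussD H D) ≤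
      (2 * k - 1 : ℝ) ^ (k * 2) * (∫ t, (c * ∑ e : ColdFreeIdx H, ‖unscaleTE H D β t e‖ ^ 2) ^ 2 ∂(gaussD H D)) ^ k := by
  simp_rw [sum_norm_unscaleTE_sq hβ, mul_div_assoc', div_eq_inv_mul, ← mul_assoc, mul_comm β⁻¹ c]
  exact integral_quadDom_pow_le (c * β⁻¹) k hk

/-- **Hypercontractive moments of `c·Σ_e ‖a_e‖⁴`** (`β ≥ 0`): `∫ (c·Σ_e‖a_e‖⁴)^{2k} dγ ≤ (2k−1)^{4k}·(∫ (c·Σ_e‖a_e‖⁴)² dγ)^k`, `k ≥ 1`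
(`m = 4`). -/
theorem integral_sum_norm_unscaleTE_pow_four_pow_le {β : ℝ} (hβ : 0 ≤ β) (c : ℝ) (k : ℕ) (hk : 1 ≤ k) :
    ∫ t, (c * ∑ e : ColdFreeIdx H, ‖unscaleTE H D β t e‖ ^ 4) ^ (2 * k) ∂(gaussD H D) ≤
      (2 * k - 1 : ℝ) ^ (k * 4) * (∫ t, (c * ∑ e : ColdFreeIdx H, ‖unscaleTE H D β t e‖ ^ 4) ^ 2 ∂(gaussD H D)) ^ k := by
  simp_rw [sum_norm_unscaleTE_pow_four hβ, mul_div_assoc', div_eq_inv_mul, ← mul_assoc, mul_comm (β ^ 2)⁻¹ c]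
  exact integral_quartDom_pow_le (c * (β ^ 2)⁻¹) k hk

end Poly

/-! ## §5 Caps: sup bounds of the dominators on the ball `{∀ e, ‖a_e‖ ≤ R}` -/

section Caps

variable {H D : ℕ}

/-- **Cap for `Σ_e ‖a_e‖²`**: if every `‖unscaleTE t e‖ ≤ R` then `Σ_e ‖a_e‖² ≤ #E_f·R²`. -/
theorem sum_norm_unscaleTE_sq_le_of_ball {β R : ℝ} (t : TSpaceD H D) (ht : ∀ e, ‖unscaleTE H D β t e‖ ≤ R) :
    ∑ e : ColdFreeIdx H, ‖unscaleTE H D β t e‖ ^ 2 ≤ (Fintype.card (ColdFreeIdx H) : ℝ) * R ^ 2 := by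
  calc ∑ e : ColdFreeIdx H, ‖unscaleTE H D β t e‖ ^ 2 ≤ ∑ _e : ColdFreeIdx H, R ^ 2 :=
        sum_le_sum fun e _ => pow_le_pow_left₀ (norm_nonneg _) (ht e) 2
    _ = _ := by rw [sum_const, nsmul_eq_mul, Finset.card_univ]

/-- **Cap for `Σ_e ‖a_e‖⁴`**: if every `‖unscaleTE t e‖ ≤ R` then `Σ_e ‖a_e‖⁴ ≤ #E_f·R⁴`. -/
theorem sum_norm_unscaleTE_pow_four_le_of_ball {β R : ℝ} (t : TSpaceD H D) (ht : ∀ e, ‖unscaleTE H D β t e‖ ≤ R) :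
    ∑ e : ColdFreeIdx H, ‖unscaleTE H D β t e‖ ^ 4 ≤ (Fintype.card (ColdFreeIdx H) : ℝ) * R ^ 4 := by
  calc ∑ e : ColdFreeIdx H, ‖unscaleTE H D β t e‖ ^ 4 ≤ ∑ _e : ColdFreeIdx H, R ^ 4 :=
        sum_le_sum fun e _ => pow_le_pow_left₀ (norm_nonneg _) (ht e) 4
    _ = _ := by rw [sum_const, nsmul_eq_mul, Finset.card_univ]

/-- Cap for the scaled quartic dominator `13440·β·Σ_e‖a_e‖⁴ ≤ 13440·β·#E_f·R⁴` on the ball (`β ≥ 0`). -/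
theorem quartic_dominator_le_of_ball {β R : ℝ} (hβ : 0 ≤ β) (t : TSpaceD H D) (ht : ∀ e, ‖unscaleTE H D β t e‖ ≤ R) :
    13440 * β * ∑ e : ColdFreeIdx H, ‖unscaleTE H D β t e‖ ^ 4 ≤ 13440 * β * ((Fintype.card (ColdFreeIdx H) : ℝ) * R ^ 4) :=
  mul_le_mul_of_nonneg_left (sum_norm_unscaleTE_pow_four_le_of_ball t ht) (by positivity)

/-- Cap for the scaled quadratic dominator `2C₂·Σ_e‖a_e‖² ≤ 2C₂·#E_f·R²` on the ball (`C₂ ≥ 0`). -/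
theorem quadratic_dominator_le_of_ball {β R C₂ : ℝ} (hC : 0 ≤ C₂) (t : TSpaceD H D) (ht : ∀ e, ‖unscaleTE H D β t e‖ ≤ R) :
    2 * C₂ * ∑ e : ColdFreeIdx H, ‖unscaleTE H D β t e‖ ^ 2 ≤ 2 * C₂ * ((Fintype.card (ColdFreeIdx H) : ℝ) * R ^ 2) :=
  mul_le_mul_of_nonneg_left (sum_norm_unscaleTE_sq_le_of_ball t ht) (by positivity)

end Caps

end Summit.QuantumFields.YangMills.Theorems.AllWindowsColdBoxBoxMidLine

end
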